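import Summits.CriticalPhenomena.PercolationContinuityZ3.Theorems.PercNearOneGluingAdditiveGluing
import Literature.Probability.Percolation.KozmaNitzanPinning
import HarnessLib

/-!
# The AFFINE gluing inequality (the lane's proved `AdditiveGluing`) transported to the forms Kozma–Nitzan's Lemma 10 consumes:
# arbitrary finite vertex type, finitely supported weights on a countable type, target SET, and the avoiding (region) form

builds on p205010 (kernel theorem, internal audit signed; external expert review pending): this file applies the tree theorem
`AdditiveGluing_proof : AdditiveGluing` (`PercNearOneGluingAdditiveGluing.lean`, = `CSH.additiveGluing_holds`).
Status sentence (coordinator 2026-08-20T04:30Z): "θ(p_c) = 0 on ℤ^d, all d ≥ 2 — kernel-verified (Lean 4/Mathlib, standard axioms); internal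
adversarial audit SIGNED 2026-08-20 04:29Z; external expert review pending."
Lane `prim-bschramm`, seat p5 (refuter, generation 2); memo `run/shared/lean/prim/bschramm/P5-SHARPNESS.md` §17.7 (iv).

WHY.  The generic Lemma 10 (`KNLevels.targetLemma_of_kits`) takes the gluing hypothesis in Kozma–Nitzan's ε–δ form (Conjecture 3) and therefore,
in Step V, has to turn the averaged reliability estimate into a pointwise one by Markov over the shell pattern, which makes the accuracy transfer
QUADRATIC (`δ = ε·min(δ_C3(ε/2),1)/12`, `h12 : 12δ ≤ ε·δc`).  The lane has since PROVED the AFFINE inequality `P(o ↔ A) − t ≤ P(o ↔ b)` for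
`t`-reliable relays (`AdditiveGluing`); with it Step V can average the affine bound over the patterns directly and the transfer becomes LINEAR
(`1 − 7δ − δ`-type conclusions).  This file supplies the affine inequality in exactly the shapes Step V needs — the transport is the one of
`L/KozmaNitzanPinning.lean` (`KozmaNitzan2024_conjecture3.fintype/.finSupp/.openConn_set`), verbatim, with the ε–δ conclusion replaced by the
affine one:
* `affineGluing_fintype` — every finite vertex type (relabel along `Fintype.equivFin`);
* `affineGluing_finSupp` — finitely supported weights on a countable vertex type (restriction coupling to the support);
* `affineGluing_set` — target SET `T` (wire `T`, `prodBernoulli_wireW_real_openConn`, monotonicity of `{o ↔ A}` under wiring);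
* `affineGluing_setIn` — relays reliable to `T` INSIDE a region (weaker hypothesis; the form of `targetLemma_of_kits`' `hC`, affine).
No new mathematics: transport only.  Everything PROVED; standard axioms.

[cite: KozmaNitzan2024, Conjecture 1 (p. 3), Conjecture 3 (p. 15), §4 p. 22 (identifying `T` to a point)]
-/

noncomputable section

open MeasureTheory ProbabilityTheory

namespace Summit.CriticalPhenomena.PercolationContinuityZ3.Theorems

namespace Transplant

namespace KNLevels

open Literature.Probability.Percolation Literature.Probability.LatticeModels

/-- **Affine gluing over every finite vertex type**: for `t ≥ 0`, if every relay `a ∈ A` satisfies `1 − t ≤ P_w(a ↔ b)` then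
`P_w(o ↔ A) − t ≤ P_w(o ↔ b)` — the tree's `AdditiveGluing` (typed over `Fin n`) relabelled along `Fintype.equivFin`.
[cite: KozmaNitzan2024, Conjecture 1 (p. 3)] -/
theorem affineGluing_fintype (V : Type) [Fintype V] (w : Sym2 V → unitInterval) (A : Finset V) (o b : V) {t : ℝ}
    (ht : 0 ≤ t) (hab : ∀ a ∈ A, 1 - t ≤ (prodBernoulli w).real (openConn a b)) :
    (prodBernoulli w).real (⋃ a ∈ A, openConn o a) - t ≤ (prodBernoulli w).real (openConn o b) := by
  classical
  set e := Fintype.equivFin V with he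
  have hf : Function.Injective (e.symm : Fin (Fintype.card V) → V) := e.symm.injective
  set w' : Sym2 (Fin (Fintype.card V)) → unitInterval := w ∘ Sym2.map e.symm with hw'
  have hmap := prodBernoulli_map_restrictConfig w hf
  have key : ∀ x y : V, (prodBernoulli w').real (openConn (e x) (e y)) = (prodBernoulli w).real (openConn x y) := by
    intro x y
    rw [hw', ← hmap, map_measureReal_apply (measurable_restrictConfig _) (measurableSet_openConn_holds _ _),
      restrictConfig_symm_preimage_openConn]
  have keyU : (prodBernoulli w').real (⋃ a ∈ A.map e.toEmbedding, openConn (e o) a) =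
      (prodBernoulli w).real (⋃ a ∈ A, openConn o a) := by
    rw [hw', ← hmap, map_measureReal_apply (measurable_restrictConfig _)
      (Finset.measurableSet_biUnion _ fun a _ => measurableSet_openConn_holds _ _)]
    congr 1
    exact restrictConfig_symm_preimage_biUnion_openConn e o A
  have h1 := AdditiveGluing_proof (Fintype.card V) w' (A.map e.toEmbedding) (e o) (e b) t ht (by
    intro a ha
    rw [Finset.mem_map_equiv] at ha
    have := hab (e.symm a) ha
    rwa [← key, Equiv.apply_symm_apply] at this)
  rwa [key, keyU] at h1

/-- **Affine gluing for finitely supported weights on a countable vertex type**: if `w` vanishes on every pair not inside the finite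
set `S`, `A ⊆ S`, `o, b ∈ S`, `t ≥ 0` and every `a ∈ A` has `1 − t ≤ P_w(a ↔ b)`, then `P_w(o ↔ A) − t ≤ P_w(o ↔ b)` (restriction coupling to
the finite graph on `S`, on which the configuration a.s. lives). [cite: KozmaNitzan2024, Conjecture 1 (p. 3)] -/
theorem affineGluing_finSupp (V : Type) [Countable V] (w : Sym2 V → unitInterval) (S : Finset V)
    (hw : ∀ e : Sym2 V, (∃ x ∈ e, x ∉ S) → w e = 0) (A : Finset V) (o b : V) (hAS : A ⊆ S) (ho : o ∈ S) (hb : b ∈ S)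
    {t : ℝ} (ht : 0 ≤ t) (hab : ∀ a ∈ A, 1 - t ≤ (prodBernoulli w).real (openConn a b)) :
    (prodBernoulli w).real (⋃ a ∈ A, openConn o a) - t ≤ (prodBernoulli w).real (openConn o b) := by
  classical
  set Sset : Set V := ↑S with hSset
  set f : Sset → V := Subtype.val with hf
  have hfi : Function.Injective f := Subtype.val_injective
  set w' : Sym2 Sset → unitInterval := w ∘ Sym2.map f with hw'
  have hmap := prodBernoulli_map_restrictConfig w hfi
  -- a.s. every open pair lies inside `S`
  have hae : ∀ᵐ ω ∂prodBernoulli w, ∀ e ∈ ω, ∀ x ∈ e, x ∈ Sset := by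
    have hZ : ({e : Sym2 V | ∃ x ∈ e, x ∉ S}).Countable := Set.to_countable _
    filter_upwards [prodBernoulli_ae_forall_notMem w hZ fun e he => hw e he] with ω hω e he x hx
    by_contra hxS
    exact hω e ⟨x, hx, hxS⟩ he
  -- transport of connection probabilities
  have key : ∀ (x y : V) (hx : x ∈ Sset) (hy : y ∈ Sset),
      (prodBernoulli w').real (openConn (⟨x, hx⟩ : Sset) ⟨y, hy⟩) = (prodBernoulli w).real (openConn x y) := by
    intro x y hx hy
    rw [hw', ← hmap, map_measureReal_apply (measurable_restrictConfig _) (measurableSet_openConn_holds _ _)]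
    refine measureReal_congr ?_
    filter_upwards [hae] with ω hω
    refine propext ⟨fun h' => ?_, fun h' => ?_⟩
    · exact reachable_map_of_restrictConfig hfi ω h'
    · exact reachable_restrictConfig_subtype_of_reachable hω hx hy h'
  set A' : Finset Sset := A.subtype (· ∈ Sset) with hA'
  have keyU : (prodBernoulli w').real (⋃ a ∈ A', openConn (⟨o, ho⟩ : Sset) a) =
      (prodBernoulli w).real (⋃ a ∈ A, openConn o a) := by
    rw [hw', ← hmap, map_measureReal_apply (measurable_restrictConfig _)
      (Finset.measurableSet_biUnion _ fun a _ => measurableSet_openConn_holds _ _)]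
    refine measureReal_congr ?_
    filter_upwards [hae] with ω hω
    change (ω ∈ restrictConfig f ⁻¹' (⋃ a ∈ A', openConn (⟨o, ho⟩ : Sset) a)) =
      (ω ∈ ⋃ a ∈ A, openConn o a)
    simp only [Set.mem_preimage, Set.mem_iUnion, exists_prop, hA', Finset.mem_subtype, eq_iff_iff]
    constructor
    · rintro ⟨a, ha, h'⟩
      exact ⟨a, ha, reachable_map_of_restrictConfig hfi ω h'⟩
    · rintro ⟨a, ha, h'⟩
      exact ⟨⟨a, hAS ha⟩, ha, reachable_restrictConfig_subtype_of_reachable hω ho (hAS ha) h'⟩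
  have h1 := affineGluing_fintype Sset w' A' ⟨o, ho⟩ ⟨b, hb⟩ ht (by
    intro a ha
    rw [hA', Finset.mem_subtype] at ha
    have := hab a ha
    rwa [← key a b a.2 hb] at this)
  rwa [key, keyU] at h1

/-- **Affine gluing with a target SET**: for finitely supported weights on a countable vertex type, `A, T ⊆ S`, `o ∈ S`, `T ≠ ∅`, `t ≥ 0`:
if every `a ∈ A` has `1 − t ≤ P_w(a ↔ T)` then `P_w(o ↔ A) − t ≤ P_w(o ↔ T)`.  Proof: apply `affineGluing_finSupp` to the wired weights
`wireW T w` and any `t₀ ∈ T` (`prodBernoulli_wireW_real_openConn`), using that `{o ↔ A}` only grows under wiring.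
[cite: KozmaNitzan2024, §4 p. 22 (identifying `T` to a point), Conjecture 1 (p. 3)] -/
theorem affineGluing_set (V : Type) [Countable V] (w : Sym2 V → unitInterval) (S : Finset V)
    (hw : ∀ e : Sym2 V, (∃ x ∈ e, x ∉ S) → w e = 0) (A T : Finset V) (o : V) (hAS : A ⊆ S) (hTS : T ⊆ S) (ho : o ∈ S)
    (hT : T.Nonempty) {t : ℝ} (ht : 0 ≤ t) (haT : ∀ a ∈ A, 1 - t ≤ (prodBernoulli w).real (⋃ t' ∈ T, openConn a t')) :
    (prodBernoulli w).real (⋃ a ∈ A, openConn o a) - t ≤ (prodBernoulli w).real (⋃ t' ∈ T, openConn o t') := by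
  obtain ⟨t₀, ht₀⟩ := hT
  have hw' : ∀ e : Sym2 V, (∃ x ∈ e, x ∉ S) → wireW (↑T : Set V) w e = 0 := by
    intro e he
    rw [wireW_apply_of_not_mem w ?_, hw e he]
    obtain ⟨x, hx, hxS⟩ := he
    exact fun h' => hxS (hTS (h'.1 x hx))
  have h1 := affineGluing_finSupp V (wireW (↑T : Set V) w) S hw' A o t₀ hAS ho (hTS ht₀) ht (by
    intro a ha
    rw [prodBernoulli_wireW_real_openConn w (↑T : Set V) (Finset.mem_coe.2 ht₀) a]
    exact haT a ha)
  rw [prodBernoulli_wireW_real_openConn w (↑T : Set V) (Finset.mem_coe.2 ht₀) o] at h1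
  exact le_trans (sub_le_sub_right (prodBernoulli_real_biUnion_openConn_mono (le_wireW _ w) o _) t) h1

/-- **Affine gluing, avoiding (region) form** — the AFFINE counterpart of the hypothesis `hC` of `KNLevels.targetLemma_of_kits`: relays reliable to
`T` INSIDE a region `Rg` are reliable, so `affineGluing_set` applies.  (`o ∉ Rg` is not needed for the inequality and is kept only to match the
ε–δ signature.) [cite: KozmaNitzan2024, Conjecture 3 (p. 15), §4 p. 22] -/
theorem affineGluing_setIn (V : Type) [Countable V] (w : Sym2 V → unitInterval) (S : Finset V)
    (hw : ∀ e : Sym2 V, (∃ x ∈ e, x ∉ S) → w e = 0) (A T : Finset V) (o : V) (Rg : Set V) (hAS : A ⊆ S) (hTS : T ⊆ S)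
    (ho : o ∈ S) (hT : T.Nonempty) {t : ℝ} (ht : 0 ≤ t)
    (haT : ∀ a ∈ A, 1 - t ≤ (prodBernoulli w).real (⋃ t' ∈ T, openConnIn Rg a t')) :
    (prodBernoulli w).real (⋃ a ∈ A, openConn o a) - t ≤ (prodBernoulli w).real (⋃ t' ∈ T, openConn o t') := by
  refine affineGluing_set V w S hw A T o hAS hTS ho hT ht fun a ha => (haT a ha).trans ?_
  refine measureReal_mono (Set.iUnion₂_mono fun t' _ ω hω => ?_) (measure_ne_top _ _)
  rw [DCT16.mem_openConnIn_iff_pathIn] at hω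
  exact reachable_of_pathIn hω

end KNLevels

end Transplant

end Summit.CriticalPhenomena.PercolationContinuityZ3.Theorems

end
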